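import Mathlib.Analysis.SpecialFunctions.Pow.Real
import Mathlib.Algebra.BigOperators.Ring.Finset
import Mathlib.Algebra.Order.BigOperators.Group.Finset
import HarnessLib

/-!
# QUANT lane R8, FAR on trees: the MERGE STEP — moving an independent blob into some leaf never raises the tail
# `P(N ≥ j+1)` once `g · (target mass) ≥ j` (law-free averaging lemma)

builds on p205010 (kernel theorem, internal audit signed; external expert review pending)

Support file (`--supports stmt-CriticalPhenomena-4575`), QUANT lane seat prim-quant-p1 (gen 8); memo
`run/shared/lean/prim/quant/P1-SURPLUS.md` §19 (the ALL-TIED normal form of `Quant.FarTreeRow`, the greedy-merge conjecture (GM)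
and its law-free cells).  Theorems only; no definitions, no sorries, standard axioms.

**Setting (abstract, law-free).**  A finite configuration space `Ω` with nonnegative weights `μ` (any law — in the application, the
joint law of everything except one gate), target leaves `κ` with integer sizes `c k`, a map `S : Ω → Finset κ` (the targets reached in
configuration `ω`), an extra integer mass `z ω` (relays reached outside the target set) and an INDEPENDENT blob of `b` relays behind a
gate of probability `g`.  The original tail at layer `j` is
`T₀ = ∑_ω μ ω · (g·𝟙[j+1 ≤ c(S ω) + z ω + b] + (1−g)·𝟙[j+1 ≤ c(S ω) + z ω])`, and the tail after MERGING the blob into target `ℓ`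
(its `b` relays now reached exactly when `ℓ` is) is `T_ℓ = ∑_ω μ ω · 𝟙[j+1 ≤ c(S ω) + z ω + b·𝟙[ℓ ∈ S ω]]`.

* `Quant.Merge.sum_size_mul_tailMerge_le` — **the merge inequality**: if `j ≤ g · ∑_k c k` then `∑_ℓ c ℓ · T_ℓ ≤ (∑_k c k) · T₀`.
  Proof: configuration by configuration.  Write `m = c(S ω) + z ω`.  If `m ≥ j+1` every indicator is `1`; if `m + b ≤ j` every indicator
  is `0`; in the window `m ≤ j < m + b` the bracket is `∑_ℓ c ℓ (𝟙[ℓ ∈ S ω] − g) = c(S ω) − g ∑ c ≤ j − g ∑ c ≤ 0`.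
* `Quant.Merge.exists_tailMerge_le` — hence, if some target has positive size, SOME merge does not raise the tail: `∃ ℓ, 0 < c ℓ ∧ T_ℓ ≤ T₀`.

**Use (P1-SURPLUS §19).**  In the all-tied normal form of FAR on trees (every relay has marginal `x`, `n x > 2j`; the interior extremal
structure of LEAD-NOTES-G10 N21 (7)) a leaf-to-leaf transfer keeps the configuration all-tied with the same `(n, x)`, so a chain of
non-increasing transfers ending in one blob (tail `= x`) proves the row.  This file is the law-free cell of that chain: a ROOT-LEVEL leaf
blob `(b, g = x)` (targets = all other leaves, `z = 0`, condition `x (n − b) ≥ j`, automatic from `n x > 2j` when no leaf alone has `j+1`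
relays), and a deep leaf `s` with its sibling side as targets (`Ω` restricted to "parent reached", `g` = own gate of `s`, `z` = mass
reached outside the parent's subtree, condition `g_s · (sibling-side mass) ≥ j`).  Nearest prior art searched (corpus fts + vsearch,
galaxy): majorisation / Schur-convexity of tail probabilities of weighted Bernoulli sums (Marshall–Olkin–Arnold ch. 12; Proschan 1965;
Gleser 1975) treat INDEPENDENT summands and symmetric weights; the window argument with an arbitrary joint law is recorded as [this work].
-/

namespace Summit.CriticalPhenomena.PercolationContinuityZ3.Theorems

namespace Quant

namespace Merge

open Finset

variable {Ω κ : Type*} [Fintype Ω] [Fintype κ] [DecidableEq κ]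

/-- The pointwise bracket of the merge inequality: for a configuration with reached target mass `cS = ∑_{k∈S} c k`, outside mass `z`,
blob size `b`, a real `g` (the blob's gate; only `j ≤ g·∑ c` is used) and `j ≤ g·∑ c`, the size-weighted sum over targets of (merged indicator − original mixture) is `≤ 0`.
Three cases: above the window all indicators are `1`, below it all are `0`, inside it the bracket is `c(S) − g ∑ c ≤ j − g ∑ c ≤ 0`.
[this work] -/
theorem sum_size_mul_bracket_nonpos (S : Finset κ) (z b j : ℕ) (c : κ → ℕ) (g : ℝ)
    (hM : (j : ℝ) ≤ g * ∑ k, (c k : ℝ)) :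
    ∑ ℓ, (c ℓ : ℝ) *
        ((if j + 1 ≤ ∑ k ∈ S, c k + z + (if ℓ ∈ S then b else 0) then (1 : ℝ) else 0) -
          (g * (if j + 1 ≤ ∑ k ∈ S, c k + z + b then (1 : ℝ) else 0) +
            (1 - g) * (if j + 1 ≤ ∑ k ∈ S, c k + z then (1 : ℝ) else 0))) ≤ 0 := by
  set m : ℕ := ∑ k ∈ S, c k + z with hm
  by_cases hhi : j + 1 ≤ m
  · -- above the window: every indicator is `1`
    have h1 : ∀ ℓ, (j + 1 ≤ m + (if ℓ ∈ S then b else 0)) := fun ℓ => le_trans hhi (Nat.le_add_right _ _)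
    have h2 : j + 1 ≤ m + b := le_trans hhi (Nat.le_add_right _ _)
    refine Finset.sum_nonpos fun ℓ _ => ?_
    rw [if_pos (h1 ℓ), if_pos h2, if_pos hhi]
    have : (1 : ℝ) - (g * 1 + (1 - g) * 1) = 0 := by ring
    rw [this, mul_zero]
  · push Not at hhi
    by_cases hlo : j + 1 ≤ m + b
    · -- inside the window: the bracket is `c(S) − g·∑ c ≤ 0`
      have hval : ∀ ℓ, ((if j + 1 ≤ m + (if ℓ ∈ S then b else 0) then (1 : ℝ) else 0) -
          (g * (if j + 1 ≤ m + b then (1 : ℝ) else 0) + (1 - g) * (if j + 1 ≤ m then (1 : ℝ) else 0))) =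
          (if ℓ ∈ S then (1 : ℝ) else 0) - g := by
        intro ℓ
        rw [if_pos hlo, if_neg (not_le.2 hhi)]
        by_cases hℓ : ℓ ∈ S
        · rw [if_pos hℓ, if_pos hℓ, if_pos hlo]; ring
        · rw [if_neg hℓ, if_neg hℓ, add_zero, if_neg (not_le.2 hhi)]; ring
      simp_rw [hval, mul_sub]
      rw [Finset.sum_sub_distrib]
      have hS : ∑ ℓ, (c ℓ : ℝ) * (if ℓ ∈ S then (1 : ℝ) else 0) = ∑ k ∈ S, (c k : ℝ) := by
        rw [← Finset.sum_filter_add_sum_filter_not Finset.univ (fun ℓ => ℓ ∈ S)]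
        have hf : Finset.univ.filter (fun ℓ => ℓ ∈ S) = S := by
          ext ℓ; simp
        rw [hf]
        have hz : ∑ ℓ ∈ Finset.univ.filter (fun ℓ => ¬ ℓ ∈ S), (c ℓ : ℝ) * (if ℓ ∈ S then (1 : ℝ) else 0) = 0 :=
          Finset.sum_eq_zero fun ℓ hℓ => by
            rw [Finset.mem_filter] at hℓ
            rw [if_neg hℓ.2, mul_zero]
        rw [hz, add_zero]
        exact Finset.sum_congr rfl fun ℓ hℓ => by rw [if_pos hℓ, mul_one]
      rw [hS, ← Finset.sum_mul]
      -- `c(S) ≤ m ≤ j ≤ g ∑ c`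
      have hcS : (∑ k ∈ S, (c k : ℝ)) ≤ (j : ℝ) := by
        have : ∑ k ∈ S, c k ≤ j := by omega
        exact_mod_cast this
      linarith
    · -- below the window: every indicator is `0`
      push Not at hlo
      refine Finset.sum_nonpos fun ℓ _ => ?_
      have h1 : ¬ (j + 1 ≤ m + (if ℓ ∈ S then b else 0)) := by
        split_ifs <;> omega
      rw [if_neg h1, if_neg (not_le.2 hlo), if_neg (not_le.2 hhi)]
      have : (0 : ℝ) - (g * 0 + (1 - g) * 0) = 0 := by ring
      rw [this, mul_zero]

/-- **The merge inequality (law-free).**  For nonnegative configuration weights `μ`, reached-target map `S`, outside mass `z`, sizes `c`,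
an independent blob `(b, g)` (any real `g`; in the application a probability) with `j ≤ g · ∑_k c k`:
`∑_ℓ c ℓ · T_ℓ ≤ (∑_k c k) · T₀`, where `T_ℓ = ∑_ω μ ω 𝟙[j+1 ≤ c(S ω) + z ω + b𝟙[ℓ ∈ S ω]]` is the tail after merging the blob into
target `ℓ` and `T₀ = ∑_ω μ ω (g 𝟙[j+1 ≤ c(S ω)+z ω+b] + (1−g) 𝟙[j+1 ≤ c(S ω)+z ω])` the original tail.  [this work] -/
theorem sum_size_mul_tailMerge_le (μ : Ω → ℝ) (hμ : ∀ ω, 0 ≤ μ ω) (S : Ω → Finset κ) (z : Ω → ℕ) (c : κ → ℕ)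
    (b j : ℕ) (g : ℝ) (hM : (j : ℝ) ≤ g * ∑ k, (c k : ℝ)) :
    ∑ ℓ, (c ℓ : ℝ) * ∑ ω, μ ω *
        (if j + 1 ≤ ∑ k ∈ S ω, c k + z ω + (if ℓ ∈ S ω then b else 0) then (1 : ℝ) else 0) ≤
      (∑ k, (c k : ℝ)) * ∑ ω, μ ω *
        (g * (if j + 1 ≤ ∑ k ∈ S ω, c k + z ω + b then (1 : ℝ) else 0) +
          (1 - g) * (if j + 1 ≤ ∑ k ∈ S ω, c k + z ω then (1 : ℝ) else 0)) := by
  rw [← sub_nonpos]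
  have hrw : ∑ ℓ, (c ℓ : ℝ) * ∑ ω, μ ω *
        (if j + 1 ≤ ∑ k ∈ S ω, c k + z ω + (if ℓ ∈ S ω then b else 0) then (1 : ℝ) else 0) -
      (∑ k, (c k : ℝ)) * ∑ ω, μ ω *
        (g * (if j + 1 ≤ ∑ k ∈ S ω, c k + z ω + b then (1 : ℝ) else 0) +
          (1 - g) * (if j + 1 ≤ ∑ k ∈ S ω, c k + z ω then (1 : ℝ) else 0)) =
      ∑ ω, μ ω * ∑ ℓ, (c ℓ : ℝ) *
        ((if j + 1 ≤ ∑ k ∈ S ω, c k + z ω + (if ℓ ∈ S ω then b else 0) then (1 : ℝ) else 0) -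
          (g * (if j + 1 ≤ ∑ k ∈ S ω, c k + z ω + b then (1 : ℝ) else 0) +
            (1 - g) * (if j + 1 ≤ ∑ k ∈ S ω, c k + z ω then (1 : ℝ) else 0))) := by
    rw [Finset.sum_mul]
    simp_rw [Finset.mul_sum, mul_sub, Finset.sum_sub_distrib]
    rw [Finset.sum_comm]
    congr 1
    · refine Finset.sum_congr rfl fun ω _ => Finset.sum_congr rfl fun ℓ _ => by ring
    · rw [Finset.sum_comm]
      refine Finset.sum_congr rfl fun ω _ => Finset.sum_congr rfl fun ℓ _ => by ring
  rw [hrw]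
  exact Finset.sum_nonpos fun ω _ =>
    mul_nonpos_of_nonneg_of_nonpos (hμ ω) (sum_size_mul_bracket_nonpos (S ω) (z ω) b j c g hM)

/-- **Some merge does not raise the tail.**  Under the hypotheses of `sum_size_mul_tailMerge_le`, if some target has positive size then
there is a target `ℓ` with `0 < c ℓ` whose merged tail is at most the original tail: `T_ℓ ≤ T₀`.  (If every `T_ℓ` with `c ℓ > 0`
exceeded `T₀`, the size-weighted average would too.)  [this work] -/
theorem exists_tailMerge_le (μ : Ω → ℝ) (hμ : ∀ ω, 0 ≤ μ ω) (S : Ω → Finset κ) (z : Ω → ℕ) (c : κ → ℕ)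
    (b j : ℕ) (g : ℝ) (hM : (j : ℝ) ≤ g * ∑ k, (c k : ℝ)) (hpos : ∃ k, 0 < c k) :
    ∃ ℓ, 0 < c ℓ ∧
      ∑ ω, μ ω * (if j + 1 ≤ ∑ k ∈ S ω, c k + z ω + (if ℓ ∈ S ω then b else 0) then (1 : ℝ) else 0) ≤
        ∑ ω, μ ω * (g * (if j + 1 ≤ ∑ k ∈ S ω, c k + z ω + b then (1 : ℝ) else 0) +
          (1 - g) * (if j + 1 ≤ ∑ k ∈ S ω, c k + z ω then (1 : ℝ) else 0)) := by
  by_contra hcon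
  push Not at hcon
  have hle := sum_size_mul_tailMerge_le μ hμ S z c b j g hM
  -- every target with positive size has a strictly larger merged tail: contradiction with the weighted average
  set T₀ := ∑ ω, μ ω * (g * (if j + 1 ≤ ∑ k ∈ S ω, c k + z ω + b then (1 : ℝ) else 0) +
          (1 - g) * (if j + 1 ≤ ∑ k ∈ S ω, c k + z ω then (1 : ℝ) else 0)) with hT₀
  have hlt : (∑ k, (c k : ℝ)) * T₀ <
      ∑ ℓ, (c ℓ : ℝ) * ∑ ω, μ ω *
        (if j + 1 ≤ ∑ k ∈ S ω, c k + z ω + (if ℓ ∈ S ω then b else 0) then (1 : ℝ) else 0) := by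
    rw [Finset.sum_mul]
    apply Finset.sum_lt_sum
    · intro ℓ _
      rcases Nat.eq_zero_or_pos (c ℓ) with h0 | hp
      · rw [h0]; simp
      · exact mul_le_mul_of_nonneg_left (le_of_lt (hcon ℓ hp)) (Nat.cast_nonneg _)
    · obtain ⟨k, hk⟩ := hpos
      exact ⟨k, Finset.mem_univ _, mul_lt_mul_of_pos_left (hcon k hk) (by exact_mod_cast hk)⟩
  linarith

end Merge

end Quant

end Summit.CriticalPhenomena.PercolationContinuityZ3.Theorems
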